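import Literature.NumberTheory.LFunctions.Zhang2022.Section12Eq1212OfRel
import Literature.NumberTheory.LFunctions.Zhang2022.RepairGapSection12U025Premise
import Literature.NumberTheory.LFunctions.Zhang2022.RepairGapSection10cInt1214Free
import Literature.NumberTheory.LFunctions.Zhang2022.RepairGapSection12Top1225Premise
import Literature.NumberTheory.LFunctions.Zhang2022.RepairGapSection8FrontEnd82Premise
import Literature.NumberTheory.LFunctions.Zhang2022.RepairGapLemma82LeafPremise
import HarnessLib

/-!
# Zhang (2022), rescue GAP/BED (D-0124 (3)(4)): §12 (12.12) p. 71 — the leaf h1212 `Typed.Sec12C.Eq1212` (the low range `dr ≤ P″₁/T` of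
# `S_j(𝐚₁₂,𝐚₂₅)`: «`= main1212sum + o(α) = main1212int + o(α)`») under the minimum premise `‖L(1,χ)‖ ≤ 𝓛⁻¹⁵`, UNCONDITIONAL for `c′ ≥ 0`

Topic `Literature/NumberTheory/LFunctions/Zhang2022` (Landau–Siegel audit tree; verdict-neutral).
Y. Zhang, *Discrete mean estimates and the Landau–Siegel zero*, arXiv:2211.02515v1 (2022)
[Zhang2022LandauSiegel] — **an unrefereed manuscript under adjudication; nothing in this file asserts or
denies its Theorems 1–2, and nothing here is a claim about Landau–Siegel zeros. The programme SEARCHES and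
TYPES; no claim about Landau–Siegel zeros, Theorems 1–2 of arXiv:2211.02515 or a repaired Margin232 until a
kernel theorem says so.**

The tree closes the leaf `Typed.Sec12C.Eq1212 c′` (binder h1212 of `Skeleton.theorem1_of_leaves_v19…v43`; a §12 main-term input of the (12.17)
evaluation) by `Typed.Sec12C.eq1212_holds` = `eq1212_of_eq1210L15Rel' hc′ eq1210L15Rel_holds` (`Section12U025RelHolds` / `Section12Eq1212OfRel`):
the first equality from Lemma 8.2 (§9.u002 sharp, §8.u041) and (12.10)ᴿ (`eq1212_first_of_eq1210L15Rel`, a THREAD over the guard-free core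
`eq1212_first_core_rel`), the second from the §10 low-range chain `lowSum1214 → lowX1214 → lowInt1214` (`eq1212_sum_sub_int`, guard idle). All
inputs are kernel at (A)-exponent 15 (`Skeleton.lemma82_pow15` p592479, `Section9Discharge.step9u002_sharp_pow15` p614362,
`Section8FrontEnd82.step8u041_pow15` p613435, `Typed.Sec12B.eq1210L15Rel_pow15` — this seat, over the u025 chain at 15 —,
`Typed.Sec10C.low1214X_free` / `low1214Int_free` p624606), so the three edges re-run VERBATIM with the guard text `AssumptionA D χ →` replaced by
`‖L(1,χ)‖ ≤ 𝓛⁻¹⁵ →` (resp. deleted) give `eq1212_sum_sub_int_free`, `eq1212_first_pow15`, `eq1212_pow15_of_first_equality` and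
**`Typed.Sec12C.eq1212_pow15` — the body of `Eq1212 c′` at guard `𝓛⁻¹⁵`, every `c′ ≥ 0`, UNCONDITIONAL** (+ `eq1212_of_assumptionAWith`, every real
`E ≥ 15`; at `E = 2022` the body of the tree theorem `eq1212_holds`). GAP reading (as-typed, planner-grade): with this file EVERY §12 main-term
input of (12.17) that a door can re-key is kernel at E = 15 (Low1522, Mid1225, Top1225Ex, Top1522Ex, (12.16), Eq1212; Win1217Ex free); Eq126 /
Eq128 and (12.17) itself consume Part I. Theorems only; no definition, no named fact; nothing about (A) itself.

## References

* Y. Zhang, arXiv:2211.02515v1 (2022), §12 (12.12) p. 71 (tex L3605–L3612), Lemma 12.2 (12.10) p. 69; §10 p. 60; Lemma 8.2.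
  [cite: Zhang2022LandauSiegel, §12 (12.12) p. 71]
-/

noncomputable section

open Complex Real ComplexConjugate
open Literature.NumberTheory.LFunctions.Zhang2022.Skeleton

namespace Literature.NumberTheory.LFunctions.Zhang2022.Typed.Sec12C

open Literature.NumberTheory.LFunctions.Zhang2022.Typed.Sec10C.Ranges1422

section Eq1212Pow15

variable (c' : ℝ)

/-- **(12.12), second equality, GUARD-FREE**: for every real `c′`, `ε > 0`, all large `D` and EVERY real primitive `χ (mod D)`, `j ∈ {1,2,3}`:
`‖main1212sum − main1212int‖ ≤ εα` — the tree proof of `eq1212_sum_sub_int` verbatim over the guard-free §10 chain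
`Typed.Sec10C.low1214X_free` / `low1214Int_free` (the (A)-binder was idle). [cite: Zhang2022LandauSiegel, §12 (12.12) p.71, tex L3607–L3612] -/
theorem eq1212_sum_sub_int_free : ∀ ε : ℝ, 0 < ε → ForAllLarge fun D _ χ =>
    ∀ j ∈ ({1, 2, 3} : Finset ℕ), ‖main1212sum c' χ j - main1212int c' χ j‖ ≤ ε * alpha D := by
  intro ε hε
  set K : ℝ := 500 * ‖bstar‖ + 1 with hK
  have hK0 : 0 < K := by positivity
  have hε' : 0 < ε / (2 * K) := by positivity
  refine ((Sec10C.low1214X_free c' _ hε').and (Sec10C.low1214Int_free c' _ hε')).mono ?_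
  intro D _ χ _ _ ⟨hX, hI⟩ j hj
  have h1 := hX j hj
  have h2 := hI j hj
  rw [main1212sum_eq, main1212int_eq c' χ hj, ← mul_sub, norm_mul]
  have hn : ‖(500 : ℂ) * bstar‖ = 500 * ‖bstar‖ := by
    rw [norm_mul]; norm_num
  rw [hn]
  have htri : ‖Sec10C.lowSum1214 c' χ j - Sec10C.lowInt1214 c' χ j‖ ≤
      ε / (2 * K) * alpha D + ε / (2 * K) * alpha D := by
    calc ‖Sec10C.lowSum1214 c' χ j - Sec10C.lowInt1214 c' χ j‖
        = ‖(Sec10C.lowSum1214 c' χ j - Sec10C.lowX1214 c' χ j) +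
            (Sec10C.lowX1214 c' χ j - Sec10C.lowInt1214 c' χ j)‖ := by ring_nf
      _ ≤ _ := (norm_add_le _ _).trans (add_le_add h1 h2)
  calc 500 * ‖bstar‖ * ‖Sec10C.lowSum1214 c' χ j - Sec10C.lowInt1214 c' χ j‖
      ≤ K * (ε / (2 * K) * alpha D + ε / (2 * K) * alpha D) :=
        mul_le_mul (by linarith) htri (norm_nonneg _) hK0.le
    _ = ε * alpha D := by field_simp; ring

/-- **(12.12), first equality, at (A)-exponent 15, UNCONDITIONAL for `c′ ≥ 0`**: for every `ε > 0`, all large `D`, every real primitive `χ (mod D)`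
with `‖L(1,χ)‖ ≤ 𝓛⁻¹⁵`, `𝐚₂₅ = conj(χϰ₁₃)`, `j ∈ {1,2,3}`: `‖S_j(𝐚₁₂,𝐚₂₅)|_{dr≤P″₁/T} − main1212sum‖ ≤ εα` — the tree edge `eq1212_first_of_eq1210L15Rel`
verbatim over `Section9Discharge.step9u002_sharp_pow15 (lemma82_pow15 hc′)`, `Section8FrontEnd82.step8u041_pow15 hc′` and
`Typed.Sec12B.eq1210L15Rel_pow15 c′`. [cite: Zhang2022LandauSiegel, §12 (12.12) p.71, tex L3605–L3612] -/
theorem eq1212_first_pow15 {c' : ℝ} (hc' : 0 ≤ c') :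
    ∀ ε : ℝ, 0 < ε → ForAllLarge fun D _ χ => ‖χ.LFunction 1‖ ≤ 1 / Real.log D ^ 15 →
      ∀ a25 : ℕ → ℂ, (∀ n, a25 n = conj (χ (n : ZMod D) * vk13 D n)) →
        ∀ j ∈ ({1, 2, 3} : Finset ℕ),
          ‖SjOn c' D j (a12 χ) a25 (rngLow D) - main1212sum c' χ j‖ ≤ ε * alpha D := by
  intro ε hε
  obtain ⟨C₉a, h9⟩ := Section9Discharge.step9u002_sharp_pow15 c' (lemma82_pow15 hc')
  obtain ⟨C₉b, h8⟩ := Section8FrontEnd82.step8u041_pow15 hc'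
  obtain ⟨C₁₀, h10⟩ := Sec12B.eq1210L15Rel_pow15 c'
  obtain ⟨K, hK0, hcore⟩ := eq1212_first_core_rel c' (C₉ := max (max C₉a C₉b) 0) (C₁₀ := max C₁₀ 0)
    (le_max_right _ _) (le_max_right _ _)
  obtain ⟨D₁, hD₁⟩ := Sec14.Eq143.four_D_t0_sq_le_bigT
  obtain ⟨D₂, hD₂⟩ := exists_nat_forall_le_ell (K / (ε * π) + 5)
  have hbig : ForAllLarge fun D _ _ => 4 * (D : ℝ) * t0 D ^ 2 ≤ bigT D ∧ K / (ε * π) + 5 ≤ ell D :=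
    ⟨max D₁ D₂, fun D _ _ hD _ _ =>
      ⟨hD₁ D (le_trans (le_max_left _ _) hD), hD₂ D (le_trans (le_max_right _ _) hD)⟩⟩
  refine ((((h9.and h8).and h10).and (Sec10C.forAllLarge_five_c c')).and hbig).mono ?_
  intro D _ χ hq hp hh hA a25 ha25 j hj
  obtain ⟨⟨⟨⟨H9, H8⟩, H10⟩, ⟨-, hℓ6, hc5⟩⟩, ⟨hT4, hℓK⟩⟩ := hh
  have hℓ5 : 5 ≤ ell D := by linarith
  have hL1 : 1 ≤ ell D := by linarith
  have hL0 : 0 < ell D := by linarith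
  have hi15 : 0 ≤ (ell D ^ 15)⁻¹ := by positivity
  have H9' : ∀ d r : ℕ, 1 ≤ d → 1 ≤ r → ((d * r : ℕ) : ℝ) < Skeleton.P3 D / bigT D →
      ‖(∑ m ∈ Finset.Ico 1 (Nsupp D),
            χ (m : ZMod D) * vk3 D (d * r * m) / (m : ℂ) ^ (1 - betaJ c' D j)) -
          deriv χ.LFunction 1 / (Real.log (Skeleton.P3 D) : ℂ) *
            frakfW c' D j 6 (Skeleton.P3 D / ((d * r : ℕ) : ℝ))‖ ≤
        max (max C₉a C₉b) 0 * (ell D ^ 15)⁻¹ := fun d r hd hr h =>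
    (H9 hA j hj d r hd hr h).trans (mul_le_mul_of_nonneg_right
      ((le_max_left _ _).trans (le_max_left _ _)) hi15)
  have H8' : ∀ d r : ℕ, 1 ≤ d → 1 ≤ r → ((d * r : ℕ) : ℝ) < Skeleton.P2 D / bigT D →
      ‖(∑ m ∈ Finset.Ico 1 (Nsupp D),
            χ (m : ZMod D) * vk2 D (d * r * m) / (m : ℂ) ^ (1 - betaJ c' D j)) -
          deriv χ.LFunction 1 / (Real.log (Skeleton.P2 D) : ℂ) *
            frakfW c' D j 7 (Skeleton.P2 D / ((d * r : ℕ) : ℝ))‖ ≤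
        max (max C₉a C₉b) 0 * (ell D ^ 15)⁻¹ := fun d r hd hr h =>
    (H8 hA j hj d r hd hr h).trans (mul_le_mul_of_nonneg_right
      ((le_max_right _ _).trans (le_max_left _ _)) hi15)
  have H10' : ∀ d r : ℕ, 1 ≤ d → 1 ≤ r → ((d * r : ℕ) : ℝ) ≤ P1pp D / bigT D →
      ‖Sec12B.sum122 c' χ j d r - Sec12B.main1210 c' χ j d r‖ ≤
        max C₁₀ 0 * (ell D ^ 15)⁻¹ * (∏ q ∈ (d * r).primeFactors, (1 - (q : ℝ)⁻¹)⁻¹) ^ 2 :=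
    fun d r hd hr h => (H10 hA j hj d r hd hr h).trans
      (mul_le_mul_of_nonneg_right (mul_le_mul_of_nonneg_right (le_max_left _ _) hi15) (sq_nonneg _))
  have key := hcore hq hp hℓ5 hc5 hT4 j H9' H8' H10' a25 ha25
  -- `K𝓛⁻¹² ≤ εα`
  obtain ⟨hαpos, hαeq, -⟩ := alpha_facts (D := D) (by linarith)
  have hKle : K ≤ ε * π * ell D := by
    have h1 : K / (ε * π) ≤ ell D := by linarith
    have := (div_le_iff₀ (by positivity)).mp h1
    linarith
  refine key.trans ?_
  rw [hαeq]
  calc K * (ell D ^ 12)⁻¹ ≤ ε * π * ell D * (ell D ^ 12)⁻¹ :=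
        mul_le_mul_of_nonneg_right hKle (by positivity)
    _ = ε * (π / ell D ^ 9) * (ell D ^ 2)⁻¹ := by field_simp
    _ ≤ ε * (π / ell D ^ 9) * 1 :=
        mul_le_mul_of_nonneg_left (inv_le_one_of_one_le₀ (one_le_pow₀ hL1)) (by positivity)
    _ = ε * (π / ell D ^ 9) := mul_one _

/-- **The leaf body at (A)-exponent 15 from its first equality at 15** (the tree edge `eq1212_of_first_equality` verbatim, guard swapped; second
equality `eq1212_sum_sub_int_free`). [cite: Zhang2022LandauSiegel, §12 (12.12) p.71] -/
theorem eq1212_pow15_of_first_equality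
    (h : ∀ ε : ℝ, 0 < ε → ForAllLarge fun D _ χ => ‖χ.LFunction 1‖ ≤ 1 / Real.log D ^ 15 →
      ∀ a25 : ℕ → ℂ, (∀ n, a25 n = conj (χ (n : ZMod D) * vk13 D n)) →
        ∀ j ∈ ({1, 2, 3} : Finset ℕ),
          ‖SjOn c' D j (a12 χ) a25 (rngLow D) - main1212sum c' χ j‖ ≤ ε * alpha D) :
    ∀ ε : ℝ, 0 < ε → ForAllLarge fun D _ χ => ‖χ.LFunction 1‖ ≤ 1 / Real.log D ^ 15 →
      ∀ a25 : ℕ → ℂ, (∀ n, a25 n = conj (χ (n : ZMod D) * vk13 D n)) →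
        ∀ j ∈ ({1, 2, 3} : Finset ℕ),
          ‖SjOn c' D j (a12 χ) a25 (rngLow D) - main1212sum c' χ j‖ ≤ ε * alpha D ∧
          ‖SjOn c' D j (a12 χ) a25 (rngLow D) - main1212int c' χ j‖ ≤ ε * alpha D := by
  intro ε hε
  have hε2 : 0 < ε / 2 := by positivity
  refine ((h _ hε2).and (eq1212_sum_sub_int_free c' _ hε2)).mono ?_
  intro D _ χ _ _ ⟨hS, hI⟩ hA a25 ha25 j hj
  have h1 := hS hA a25 ha25 j hj
  have h2 := hI j hj
  have hα : 0 ≤ alpha D :=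
    nonneg_of_mul_nonneg_right ((norm_nonneg _).trans h1) hε2
  refine ⟨h1.trans (by nlinarith), ?_⟩
  calc ‖SjOn c' D j (a12 χ) a25 (rngLow D) - main1212int c' χ j‖
      = ‖(SjOn c' D j (a12 χ) a25 (rngLow D) - main1212sum c' χ j) +
          (main1212sum c' χ j - main1212int c' χ j)‖ := by ring_nf
    _ ≤ ε / 2 * alpha D + ε / 2 * alpha D := (norm_add_le _ _).trans (add_le_add h1 h2)
    _ = ε * alpha D := by ring

end Eq1212Pow15

/-- **Leaf h1212 — `Typed.Sec12C.Eq1212 c′` ((12.12): the low range `dr ≤ P″₁/T` of `S_j(𝐚₁₂,𝐚₂₅)`) with its guard `AssumptionA D χ` replaced by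
`‖L(1,χ)‖ ≤ 𝓛⁻¹⁵`, for every `c′ ≥ 0`, UNCONDITIONAL**: `eq1212_pow15_of_first_equality (eq1212_first_pow15 hc′)`.
[cite: Zhang2022LandauSiegel, §12 (12.12) p.71] -/
theorem eq1212_pow15 {c' : ℝ} (hc' : 0 ≤ c') :
    ∀ ε : ℝ, 0 < ε → ForAllLarge fun D _ χ => ‖χ.LFunction 1‖ ≤ 1 / Real.log D ^ 15 →
      ∀ a25 : ℕ → ℂ, (∀ n, a25 n = conj (χ (n : ZMod D) * vk13 D n)) →
        ∀ j ∈ ({1, 2, 3} : Finset ℕ),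
          ‖SjOn c' D j (a12 χ) a25 (rngLow D) - main1212sum c' χ j‖ ≤ ε * alpha D ∧
          ‖SjOn c' D j (a12 χ) a25 (rngLow D) - main1212int c' χ j‖ ≤ ε * alpha D :=
  eq1212_pow15_of_first_equality c' (eq1212_first_pow15 hc')

/-- **Leaf h1212 under `Repair.Bed.AssumptionAWith E`, every real `E ≥ 15`, UNCONDITIONAL for `c′ ≥ 0`** (transfer of `eq1212_pow15`; at the
printed `E = 2022` this is the body of the tree theorem `Typed.Sec12C.eq1212_holds`, not restated). [cite: Zhang2022LandauSiegel, §12 (12.12) p.71] -/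
theorem eq1212_of_assumptionAWith {c' : ℝ} (hc' : 0 ≤ c') {E : ℝ} (hE : 15 ≤ E) :
    ∀ ε : ℝ, 0 < ε → ForAllLarge fun D _ χ => Repair.Bed.AssumptionAWith E D χ →
      ∀ a25 : ℕ → ℂ, (∀ n, a25 n = conj (χ (n : ZMod D) * vk13 D n)) →
        ∀ j ∈ ({1, 2, 3} : Finset ℕ),
          ‖SjOn c' D j (a12 χ) a25 (rngLow D) - main1212sum c' χ j‖ ≤ ε * alpha D ∧
          ‖SjOn c' D j (a12 χ) a25 (rngLow D) - main1212int c' χ j‖ ≤ ε * alpha D :=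
  fun ε hε => Repair.Gap.forAllLarge_assumptionAWith_of_pow15 hE (eq1212_pow15 hc' ε hε)

end Literature.NumberTheory.LFunctions.Zhang2022.Typed.Sec12C

end
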